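import Literature.Dynamics.SymbolicDynamics.Hochman2025Certificates
import Mathlib.Analysis.SpecialFunctions.Complex.Arg
import Mathlib.Analysis.SpecialFunctions.Trigonometric.Bounds
import HarnessLib

/-!
# Hochman 2025, Lemma 5.4: orienting a stack of almost-radial boxes across a small continuum

M. Hochman, *Irreducibility and periodicity in `ℤ²` symbolic systems* (Discrete Analysis
2025:17), Lemma 5.4: given an `n`-frame with centre `c` and a connected set `E` in the annulus
`F ∖ ⅕F` of diameter `> rₙ/100`, there are `Nₙ + 1` almost-radial rectangles with a common
orientation `θ ∈ Θ = {2πk/T}` each of which is crossed by `E`. The proof ("choose `u, v ∈ Θ`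
that differ by an angle of `2π/1000` ... one of these projections of `E` is an interval of length
at least `c rₙ`") is the following elementary statement about the `T` quantized orientations
`Plane.orient T k = e^{2πik/T}` and the frame coordinates `Plane.coords` of
`Hochman2025Certificates.lean`, which we prove here (`Plane.exists_tilt`):

Let `P` be any set of points within `0.011 r` of a point `p₀` at distance
`d ∈ [0.15 r, 0.975 r]` from `c`, let `q` be a point with `|q - p₀| ≥ 0.009 r`, and let
`0 ≤ w₀` with `T w₀ ≤ r/100` (`T ≥ 1000`). Then for some orientation `k`, in the frame
`(orient T k, c)` every point of `P` has first coordinate in `[-0.99 r, -0.1 r]` and second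
coordinate in `[-r/25, r/25]` (the zone of the boxes of a frame of radius `r`), and the second
coordinates of `q` and `p₀` differ by at least `w₀` (so a stack of boxes of total width `w₀` can
be placed with transverse projection inside that of `P`).

Proof: take `k₀` with `orient T k₀` within angle `π/T` of the direction from `p₀` to `c`
(`exists_orient_near`, via `Complex.arg` and rounding); if the transverse separation of `q, p₀`
in this frame is `< w₀` then their radial separation is `≥ 0.009 r - w₀`, and in the adjacent
frame `k₀ + 1` (rotated by `2π/T`, `sin (2π/T) ≥ 4/T`) the transverse separation is
`≥ 4(0.009 r - w₀)/T - w₀ ≥ w₀`; in both frames the angle to `p₀` is `≤ 3π/T ≤ 0.012`, which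
keeps `P` inside the zone.

## References

* [Hochman2025] M. Hochman, op. cit., Lemma 5.4 (p. 23) and its use in §6.3 Steps C–D.
-/

noncomputable section

open Complex Real

namespace Literature.Dynamics.SymbolicDynamics

namespace Hochman2025

namespace Plane

/-- **Nearest quantized orientation.** Every unit vector `w` is `orient T k · e^{iε}` for some
orientation index `k` and `|ε| ≤ π/T`. [cite: Hochman2025, Lemma 5.4 (choice of `u ∈ Θ`)] -/
theorem exists_orient_near {T : ℕ} (hT : 0 < T) (w : ℂ) (hw : ‖w‖ = 1) :
    ∃ k : Fin T, ∃ ε : ℝ, |ε| ≤ π / T ∧ w = orient T k * exp (ε * I) := by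
  set θ : ℝ := arg w with hθ
  have hwθ : w = exp (θ * I) := by
    have := norm_mul_exp_arg_mul_I w
    rw [hw] at this; push_cast at this; rw [one_mul] at this
    exact this.symm
  have hTr : (0 : ℝ) < T := by exact_mod_cast hT
  set m : ℤ := round (θ * T / (2 * π)) with hm
  set ε : ℝ := θ - 2 * π * m / T with hε
  -- the orientation index `k = m mod T`
  set ρ : ℤ := m % (T : ℤ) with hρ
  have hρ0 : 0 ≤ ρ := Int.emod_nonneg _ (by exact_mod_cast hT.ne')
  have hρT : ρ < T := Int.emod_lt_of_pos _ (by exact_mod_cast hT)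
  have hρeq : (T : ℤ) * (m / T) + ρ = m := Int.mul_ediv_add_emod m T
  set k : Fin T := ⟨ρ.toNat, by
    have : (ρ.toNat : ℤ) < T := by rw [Int.toNat_of_nonneg hρ0]; exact hρT
    exact_mod_cast this⟩ with hk
  refine ⟨k, ε, ?_, ?_⟩
  · -- `|ε| ≤ π / T`
    have e : ε = 2 * π / T * (θ * T / (2 * π) - m) := by
      rw [hε]; field_simp
    rw [e, abs_mul, abs_of_pos (by positivity)]
    have := abs_sub_round (θ * T / (2 * π))
    rw [← hm] at this
    calc 2 * π / T * |θ * T / (2 * π) - m| ≤ 2 * π / T * (1 / 2) :=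
          mul_le_mul_of_nonneg_left this (by positivity)
      _ = π / T := by ring
  · -- `w = orient T k * exp (ε I)`
    have hkc : ((k : ℕ) : ℂ) = ((ρ : ℤ) : ℂ) := by
      have h1 : ((k : ℕ) : ℤ) = ρ := by rw [hk]; exact Int.toNat_of_nonneg hρ0
      rw [← h1]; norm_cast
    have horient : orient T k = exp (2 * π * I * (m : ℂ) / (T : ℂ)) := by
      unfold orient
      rw [show ((k : Fin T) : ℂ) = ((k : ℕ) : ℂ) from rfl, hkc]
      have hρ' : (ρ : ℂ) = (m : ℂ) - (T : ℂ) * ((m / T : ℤ) : ℂ) := by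
        have : (ρ : ℤ) = m - T * (m / T) := by linarith
        rw [this]; push_cast; ring
      rw [hρ']
      have hTc : (T : ℂ) ≠ 0 := by exact_mod_cast hT.ne'
      rw [show 2 * (π : ℂ) * I * ((m : ℂ) - (T : ℂ) * ((m / T : ℤ) : ℂ)) / (T : ℂ) =
        2 * π * I * (m : ℂ) / (T : ℂ) + ((-(m / T) : ℤ) : ℂ) * (2 * π * I) by
          field_simp; push_cast; ring]
      rw [Complex.exp_add, exp_int_mul_two_pi_mul_I, mul_one]
    rw [horient, ← Complex.exp_add, hwθ]
    congr 1
    rw [hε]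
    have hTc : (T : ℂ) ≠ 0 := by exact_mod_cast hT.ne'
    push_cast
    field_simp
    ring

/-- **The adjacent orientation** is rotated by `2π/T`. [cite: Hochman2025, Lemma 5.4] -/
theorem orient_succ {T : ℕ} (hT : 0 < T) (k : Fin T) :
    orient T ⟨(k + 1) % T, Nat.mod_lt _ hT⟩ = orient T k * exp (((2 * π / T : ℝ) : ℂ) * I) := by
  unfold orient
  set a : ℕ := ((k : ℕ) + 1) / T with ha
  set b : ℕ := ((k : ℕ) + 1) % T with hb
  have hab : T * a + b = (k : ℕ) + 1 := Nat.div_add_mod _ _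
  have habc : (T : ℂ) * (a : ℂ) + (b : ℂ) = ((k : ℕ) : ℂ) + 1 := by exact_mod_cast hab
  have hbc : (b : ℂ) = ((k : ℕ) : ℂ) + 1 - (T : ℂ) * (a : ℂ) := by linear_combination habc
  have hTc : (T : ℂ) ≠ 0 := by exact_mod_cast hT.ne'
  rw [show ((⟨b, Nat.mod_lt _ hT⟩ : Fin T) : ℂ) = (b : ℂ) from rfl, hbc]
  rw [show ((k : Fin T) : ℂ) = ((k : ℕ) : ℂ) from rfl]
  rw [show 2 * (π : ℂ) * I * (((k : ℕ) : ℂ) + 1 - (T : ℂ) * (a : ℂ)) / (T : ℂ) =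
    2 * π * I * ((k : ℕ) : ℂ) / T + ((2 * π / T : ℝ) : ℂ) * I + ((-(a : ℤ) : ℤ) : ℂ) * (2 * π * I) by
        push_cast; field_simp; ring]
  rw [Complex.exp_add, Complex.exp_add, exp_int_mul_two_pi_mul_I, mul_one]

/-- Frame coordinates of a point `p₀` with `p₀ - c = -d · v · e^{iε}`: `(-d cos ε, -d sin ε)`.
[folklore] -/
theorem coords_of_tilt {v c p₀ : ℂ} (hv : ‖v‖ = 1) {d ε : ℝ}
    (h : p₀ - c = -(d : ℂ) * v * exp (ε * I)) :
    coords v c p₀ = (-(d * Real.cos ε), -(d * Real.sin ε)) := by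
  have hvv : starRingEnd ℂ v * v = 1 := by
    rw [Complex.conj_mul', hv]; norm_num
  have key : starRingEnd ℂ v * (p₀ - c) = -(d : ℂ) * exp (ε * I) := by
    rw [h]
    calc starRingEnd ℂ v * (-(d : ℂ) * v * exp (ε * I))
        = -(d : ℂ) * (starRingEnd ℂ v * v) * exp (ε * I) := by ring
      _ = -(d : ℂ) * exp (ε * I) := by rw [hvv, mul_one]
  simp only [coords, key]
  ext
  · simp [Complex.exp_ofReal_mul_I_re]
  · simp [Complex.exp_ofReal_mul_I_im]

/-- Differences of frame coordinates are the real and imaginary parts of `v̄ (p - q)`.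
[folklore] -/
theorem coords_sub_coords (v c p q : ℂ) :
    (coords v c p).1 - (coords v c q).1 = (starRingEnd ℂ v * (p - q)).re ∧
      (coords v c p).2 - (coords v c q).2 = (starRingEnd ℂ v * (p - q)).im := by
  simp only [coords, ← Complex.sub_re, ← Complex.sub_im, ← mul_sub]
  constructor <;> congr 1 <;> ring

/-- **A tilted frame keeps a small set in the box zone.** If `p₀ - c = -d v e^{iε}` with
`0.15 r ≤ d ≤ 0.975 r`, `|ε| ≤ 0.012`, then every point within `0.011 r` of `p₀` has frame
coordinates in `[-0.99 r, -0.1 r] × [-r/25, r/25]`. [cite: Hochman2025, Lemma 5.4 (1)] -/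
theorem mem_zone_of_tilt {v c p₀ : ℂ} (hv : ‖v‖ = 1) {r d ε : ℝ} (hr : 0 < r)
    (hd1 : 3 / 20 * r ≤ d) (hd2 : d ≤ 39 / 40 * r) (hε : |ε| ≤ 12 / 1000)
    (h : p₀ - c = -(d : ℂ) * v * exp (ε * I)) {p : ℂ} (hp : ‖p - p₀‖ ≤ 11 / 1000 * r) :
    -(99 / 100 * r) ≤ (coords v c p).1 ∧ (coords v c p).1 ≤ -(r / 10) ∧ |(coords v c p).2| ≤ r / 25 := by
  have h0 := coords_of_tilt hv h
  obtain ⟨e1, e2⟩ := coords_sub_coords v c p p₀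
  rw [h0] at e1 e2
  simp only at e1 e2
  have hn : ‖starRingEnd ℂ v * (p - p₀)‖ = ‖p - p₀‖ := by
    rw [norm_mul, Complex.norm_conj, hv, one_mul]
  have hre : |(starRingEnd ℂ v * (p - p₀)).re| ≤ 11 / 1000 * r :=
    le_trans (Complex.abs_re_le_norm _) (by rw [hn]; exact hp)
  have him : |(starRingEnd ℂ v * (p - p₀)).im| ≤ 11 / 1000 * r :=
    le_trans (Complex.abs_im_le_norm _) (by rw [hn]; exact hp)
  rw [abs_le] at hre him hε
  -- trigonometric bounds
  have hcos1 : Real.cos ε ≤ 1 := Real.cos_le_one ε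
  have hcos2 : 1 - ε ^ 2 / 2 ≤ Real.cos ε := Real.one_sub_sq_div_two_le_cos
  have hcos3 : 9999 / 10000 ≤ Real.cos ε := by nlinarith
  have hsin : |Real.sin ε| ≤ 12 / 1000 := le_trans Real.abs_sin_le_abs (abs_le.mpr hε)
  rw [abs_le] at hsin
  have hd0 : 0 ≤ d := by linarith
  refine ⟨?_, ?_, ?_⟩
  · have : (coords v c p).1 = -(d * Real.cos ε) + (starRingEnd ℂ v * (p - p₀)).re := by linarith
    rw [this]
    nlinarith
  · have : (coords v c p).1 = -(d * Real.cos ε) + (starRingEnd ℂ v * (p - p₀)).re := by linarith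
    rw [this]
    nlinarith
  · have : (coords v c p).2 = -(d * Real.sin ε) + (starRingEnd ℂ v * (p - p₀)).im := by linarith
    rw [this, abs_le]
    constructor <;> nlinarith

/-- **Hochman 2025, Lemma 5.4 (orientation of the new boxes).** See the module docstring: for a
set `P` of points within `0.011 r` of `p₀`, `|p₀ - c| ∈ [0.15 r, 0.975 r]`, a point `q`
with `|q - p₀| ≥ 0.009 r`, and `0 ≤ w₀`, `T w₀ ≤ r/100`, `T ≥ 1000`, some orientation `k` puts
`P` in the box zone `[-0.99 r, -0.1 r] × [-r/25, r/25]` of the frame `(orient T k, c)` with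
transverse separation of `q` and `p₀` at least `w₀`. [cite: Hochman2025, Lemma 5.4] -/
theorem exists_tilt {T : ℕ} (hT : 1000 ≤ T) {r : ℝ} (hr : 0 < r) {c p₀ q : ℂ} {P : Set ℂ}
    (hd1 : 3 / 20 * r ≤ ‖p₀ - c‖) (hd2 : ‖p₀ - c‖ ≤ 39 / 40 * r)
    (hP : ∀ p ∈ P, ‖p - p₀‖ ≤ 11 / 1000 * r) (hρ : 9 / 1000 * r ≤ ‖q - p₀‖)
    {w₀ : ℝ} (hw₀ : 0 ≤ w₀) (hTw : T * w₀ ≤ r / 100) :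
    ∃ k : Fin T,
      (∀ p ∈ P, -(99 / 100 * r) ≤ (coords (orient T k) c p).1 ∧ (coords (orient T k) c p).1 ≤ -(r / 10) ∧
        |(coords (orient T k) c p).2| ≤ r / 25) ∧
      w₀ ≤ |(coords (orient T k) c q).2 - (coords (orient T k) c p₀).2| := by
  have hT0 : 0 < T := lt_of_lt_of_le (by norm_num) hT
  have hTr : (1000 : ℝ) ≤ T := by exact_mod_cast hT
  have hTpos : (0 : ℝ) < T := by linarith
  set d : ℝ := ‖p₀ - c‖ with hd
  have hdpos : 0 < d := lt_of_lt_of_le (by positivity) hd1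
  -- the unit vector from `p₀` to `c` and its nearest orientation
  set w : ℂ := ((d⁻¹ : ℝ) : ℂ) * (c - p₀) with hw
  have hwn : ‖w‖ = 1 := by
    rw [hw, norm_mul, Complex.norm_real, Real.norm_eq_abs, abs_of_pos (inv_pos.mpr hdpos),
      ← norm_neg, neg_sub, ← hd, inv_mul_cancel₀ hdpos.ne']
  obtain ⟨k₀, ε₀, hε₀, hwk⟩ := exists_orient_near hT0 w hwn
  set v₀ := orient T k₀ with hv₀
  have hv₀n : ‖v₀‖ = 1 := norm_orient T k₀
  have hcp : c - p₀ = (d : ℂ) * w := by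
    rw [hw, ← mul_assoc]
    have : (d : ℂ) * ((d⁻¹ : ℝ) : ℂ) = 1 := by
      rw [← Complex.ofReal_mul, mul_inv_cancel₀ hdpos.ne']; simp
    rw [this, one_mul]
  have htilt₀ : p₀ - c = -(d : ℂ) * v₀ * exp (ε₀ * I) := by
    have : p₀ - c = -(c - p₀) := by ring
    rw [this, hcp, hwk]; ring
  -- angle bounds: `π/T ≤ 0.004`, `3π/T ≤ 0.012`
  have hpi4 : π ≤ 4 := Real.pi_le_four
  have hπT : π / T ≤ 4 / 1000 := by
    rw [div_le_div_iff₀ hTpos (by norm_num)]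
    have : (4 : ℝ) * 1000 ≤ 4 * T := by linarith
    linarith
  -- the transverse separation in frame `k₀`
  set z₀ : ℂ := starRingEnd ℂ v₀ * (q - p₀) with hz₀
  have hz₀n : ‖z₀‖ = ‖q - p₀‖ := by rw [hz₀, norm_mul, Complex.norm_conj, hv₀n, one_mul]
  have hsep₀ : (coords v₀ c q).2 - (coords v₀ c p₀).2 = z₀.im := (coords_sub_coords v₀ c q p₀).2
  by_cases hcase : w₀ ≤ |z₀.im|
  · -- orientation `k₀` works
    refine ⟨k₀, fun p hp => ?_, by rw [hsep₀]; exact hcase⟩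
    exact mem_zone_of_tilt hv₀n hr hd1 hd2 (le_trans hε₀ (by linarith)) htilt₀ (hP p hp)
  · -- switch to the adjacent orientation `k₁ = k₀ + 1`
    push Not at hcase
    set α : ℝ := 2 * π / T with hα
    set k₁ : Fin T := ⟨(k₀ + 1) % T, Nat.mod_lt _ hT0⟩ with hk₁
    set v₁ := orient T k₁ with hv₁
    have hv₁n : ‖v₁‖ = 1 := norm_orient T k₁
    have hv₁v₀ : v₁ = v₀ * exp ((α : ℂ) * I) := by rw [hv₁, hk₁, orient_succ hT0 k₀]
    have htilt₁ : p₀ - c = -(d : ℂ) * v₁ * exp (((ε₀ - α : ℝ)) * I) := by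
      rw [htilt₀, hv₁v₀]
      rw [show -(d : ℂ) * (v₀ * exp ((α : ℂ) * I)) * exp (((ε₀ - α : ℝ) : ℂ) * I) =
        -(d : ℂ) * v₀ * (exp ((α : ℂ) * I) * exp (((ε₀ - α : ℝ) : ℂ) * I)) by ring]
      rw [← Complex.exp_add]
      congr 2
      push_cast; ring
    have hαpos : 0 < α := by rw [hα]; positivity
    have hαle : α ≤ π / 2 := by
      rw [hα, div_le_div_iff₀ hTpos (by norm_num)]
      have : π * 4 ≤ π * T := mul_le_mul_of_nonneg_left (by linarith) Real.pi_pos.le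
      linarith
    have hε₁ : |ε₀ - α| ≤ 12 / 1000 := by
      have h1 : |ε₀ - α| ≤ |ε₀| + |α| := abs_sub _ _
      have h2 : |α| = 2 * (π / T) := by rw [abs_of_pos hαpos, hα]; ring
      linarith
    refine ⟨k₁, fun p hp => mem_zone_of_tilt hv₁n hr hd1 hd2 hε₁ htilt₁ (hP p hp), ?_⟩
    -- transverse separation in frame `k₁`
    have hsep₁ : (coords v₁ c q).2 - (coords v₁ c p₀).2 = (exp (-((α : ℂ) * I)) * z₀).im := by
      rw [(coords_sub_coords v₁ c q p₀).2, hv₁v₀, map_mul, hz₀, ← mul_assoc]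
      congr 2
      rw [mul_comm]
      congr 1
      rw [← Complex.exp_conj]
      congr 1
      simp [Complex.conj_ofReal]
    rw [hsep₁]
    have him : (exp (-((α : ℂ) * I)) * z₀).im = Real.cos α * z₀.im - Real.sin α * z₀.re := by
      have e : -((α : ℂ) * I) = ((-α : ℝ) : ℂ) * I := by push_cast; ring
      rw [e, Complex.mul_im, Complex.exp_ofReal_mul_I_re, Complex.exp_ofReal_mul_I_im,
        Real.cos_neg, Real.sin_neg]
      ring
    rw [him]
    -- `|z₀.re| ≥ 0.009 r - w₀`
    have hw₀small : 1000 * w₀ ≤ r / 100 :=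
      le_trans (mul_le_mul_of_nonneg_right hTr hw₀) hTw
    have hw09 : w₀ ≤ 9 / 1000 * r := by linarith
    have hre : 9 / 1000 * r - w₀ ≤ |z₀.re| := by
      have hsq : ‖z₀‖ ^ 2 = z₀.re ^ 2 + z₀.im ^ 2 := by
        rw [Complex.sq_norm, Complex.normSq_apply]; ring
      have h1 : (9 / 1000 * r) ^ 2 ≤ ‖z₀‖ ^ 2 := by
        rw [hz₀n]; exact pow_le_pow_left₀ (by positivity) hρ 2
      have h2 : z₀.im ^ 2 < w₀ ^ 2 := by
        have : |z₀.im| < |w₀| := by rwa [abs_of_nonneg hw₀]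
        exact sq_lt_sq.mpr this
      have hprod : 0 ≤ w₀ * (9 / 1000 * r - w₀) := mul_nonneg hw₀ (by linarith)
      have h3 : (9 / 1000 * r - w₀) ^ 2 ≤ z₀.re ^ 2 := by nlinarith
      have h4 : 0 ≤ 9 / 1000 * r - w₀ := by linarith
      rw [← sq_abs z₀.re] at h3
      exact (pow_le_pow_iff_left₀ h4 (abs_nonneg _) two_ne_zero).mp h3
    -- `sin α ≥ 4 / T`
    have hsin : 4 / T ≤ Real.sin α := by
      have := Real.mul_le_sin hαpos.le hαle
      rw [hα] at this ⊢
      have e : 2 / π * (2 * π / T) = 4 / T := by field_simp; ring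
      linarith [e]
    have hcos : |Real.cos α| ≤ 1 := Real.abs_cos_le_one α
    -- conclude
    have hmain : w₀ ≤ Real.sin α * |z₀.re| - |z₀.im| := by
      have h1 : 4 / T * (9 / 1000 * r - w₀) ≤ Real.sin α * |z₀.re| := by
        have hs0 : 0 ≤ Real.sin α := le_trans (by positivity) hsin
        calc 4 / T * (9 / 1000 * r - w₀) ≤ Real.sin α * (9 / 1000 * r - w₀) :=
              mul_le_mul_of_nonneg_right hsin (by linarith)
          _ ≤ Real.sin α * |z₀.re| := mul_le_mul_of_nonneg_left hre hs0
      have h2 : 2 * w₀ ≤ 4 / T * (9 / 1000 * r - w₀) := by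
        rw [div_mul_eq_mul_div, le_div_iff₀ hTpos]
        have e : 2 * w₀ * T = 2 * (T * w₀) := by ring
        rw [e]
        linarith
      linarith [hcase.le]
    calc w₀ ≤ Real.sin α * |z₀.re| - |z₀.im| := hmain
      _ ≤ |Real.cos α * z₀.im - Real.sin α * z₀.re| := by
          have h1 : |Real.sin α * z₀.re| = Real.sin α * |z₀.re| := by
            rw [abs_mul, abs_of_nonneg (le_trans (by positivity) hsin)]
          have h2 : |Real.cos α * z₀.im| ≤ |z₀.im| := by
            rw [abs_mul]; exact mul_le_of_le_one_left (abs_nonneg _) hcos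
          have h3 := abs_sub_abs_le_abs_sub (Real.sin α * z₀.re) (Real.cos α * z₀.im)
          rw [abs_sub_comm] at h3
          linarith

end Plane

end Hochman2025

end Literature.Dynamics.SymbolicDynamics
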